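import Literature.Probability.Percolation.MarkedLoopTripodCharacter
import Literature.Probability.Percolation.MarkedLoopCatalan
import HarnessLib

/-!
# The invariant triangles of the order-three rotation are counted by a Catalan number

Topic `Literature/Probability/Percolation`; generic-`k` layer, a rider on `MarkedLoopTripodCharacter.lean` («TRIPOD-REP»: for `k = 3r` the
character of the rotation `rot^r` on the tripod-law solution space is `tr (rot^r | solW k) = −τ² · N` with `N` the number of INVARIANT
TRIANGLE PICTURES `(α, α+r, α+2r; L₀)`, `rot^r L₀ = L₀` — `shift_eq_self_iff_of_three_mul`, `trace_solWRot_third_eq`; the count `N` was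
left unevaluated: «the lane's exact tables give (k/3)·C_{(k−3)/6}, not typed») and on `MarkedLoopCatalan.lean` («LINK-CATALAN»:
`#NCMatching (2n) = catalan n`, `pullRel`). THIS FILE TYPES THE COUNT.

## Content
* `arcEmb c` — the `r − 1` points of the open arc `(c, c + r)` of `Fin (3r)`, re-indexed by `Fin (r − 1)` (`c ∈ {0, r, 2r}`);
  ★ `arc_closed` (in a tripod picture on the triangle `(0, r, 2r)` every chord stays inside one arc — it cannot cross the triangle);
  `glue₃ A` — three translated copies of a relation `A` on `Fin (r − 1)`; ★ `tripodPicture_glue₃` (for a link pattern `A` it is a tripod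
  picture on `(0, r, 2r)`), ★ `relMap_rot_pow_glue₃` (it is `rot^r`-invariant); ★★ `baseEquiv :
  {L₀ // TripodPicture 0 r (2r) L₀ ∧ rot^r L₀ = L₀} ≃ NCMatching (r − 1)` (an invariant relation is determined by its first arc).
* ★★ `invTriEquiv : {P : Pic (3r) // β = α + r, γ = α + 2r, rot^r L₀ = L₀} ≃ Fin r × {L₀ // …}` (rotate the apex `α < r` back to `0`),
  hence ★★★ `card_invariantTriangles : #{P : Pic (3r) | shift P = P} = r · #NCMatching (r − 1)` and, for `r = 2s + 1` (the case with `k = 3r`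
  odd), ★★★ `card_invariantTriangles_eq_mul_catalan : … = (2s+1) · catalan s` — REP's table `1, 3, 10` for `k = 3, 9, 15` and every further
  value `(k/3) · C_{(k−3)/6}`.
* ★★★ `trace_solWRot_third_eq_catalan : tr (rot^{2s+1} | solW (3(2s+1))) = −τ² · ((2s+1) · catalan s)` — THE CHARACTER OF
  KHRISTOFOROV–SMIRNOV'S ROTATION AT ITS ORDER-THREE ELEMENT, EXPLICITLY, for every odd `k` divisible by `3`.

## References
* M. Khristoforov, S. Smirnov, *Percolation and O(1) loop model*, arXiv:2111.15612 (2021), §1.2 (arXiv v1 p. 2: cyclic indexing, the link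
  pattern), §2 Lemma 4 with its proof and Fig. 3 (p. 4).
* R. P. Grimaldi, *Fibonacci and Catalan Numbers: An Introduction*, Wiley (2012), Example 32.3 (pp. 255–257) — through `MarkedLoopCatalan`.
-/

open Finset

namespace Literature.Probability.Percolation.MarkedLoops

open Literature.Probability.Percolation.FivePoint (tau)

section Triangles

variable {nm r : ℕ}

/-- re-indexing is compatible with anticlockwise quadruples (strictly increasing maps). [folklore] -/
private theorem ccwQuad_iff_of_strictMono₃ {m m' : ℕ} {e : Fin m' → Fin m} (he : StrictMono e) {a b c d : Fin m'} :
    CcwQuad (e a) (e b) (e c) (e d) ↔ CcwQuad a b c d := by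
  unfold CcwQuad
  simp only [he.lt_iff_lt]

/-! #### The three arcs of the base triangle `(0, r, 2r)` -/

/-- **the open arc `(c, c + r)`** of `Fin k`, `k = 3r`, re-indexed by `Fin (r − 1)` (used with `c = 0, r, 2r`). [folklore] -/
def arcEmb (c : ℕ) (hc : c + r ≤ nm) (x : Fin (r - 1)) : Fin nm := ⟨c + 1 + x.1, by have := x.2; omega⟩

/-- values of the arc re-indexing. [folklore] -/
@[simp] private theorem val_arcEmb {c : ℕ} (hc : c + r ≤ nm) (x : Fin (r - 1)) : (arcEmb c hc x).1 = c + 1 + x.1 := rfl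

/-- the arc re-indexing is increasing. [folklore] -/
private theorem strictMono_arcEmb {c : ℕ} (hc : c + r ≤ nm) : StrictMono (arcEmb (r := r) c hc) := fun x y h => by
  rw [Fin.lt_def] at h ⊢; simp only [val_arcEmb]; omega

/-- range of the arc re-indexing. [folklore] -/
private theorem arcEmb_bounds {c : ℕ} (hc : c + r ≤ nm) (x : Fin (r - 1)) : c < (arcEmb c hc x).1 ∧ (arcEmb c hc x).1 < c + r := by
  have := x.2; simp only [val_arcEmb]; omega

/-- every point of the open arc is re-indexed. [folklore] -/
private theorem exists_arcEmb_eq {c : ℕ} (hc : c + r ≤ nm) {x : Fin nm} (h1 : c < x.1) (h2 : x.1 < c + r) :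
    ∃ a : Fin (r - 1), arcEmb c hc a = x :=
  ⟨⟨x.1 - (c + 1), by omega⟩, Fin.ext (by simp only [val_arcEmb]; omega)⟩

/-- the corners `0`, `r`, `2r` of the base triangle (as points of `Fin k`, `k = 3r`, `r > 0`). [folklore] -/
def corner₀ (hr : 3 * r = nm) (hpos : 0 < r) : Fin nm := ⟨0, by omega⟩

/-- Auxiliary. [folklore] -/
def corner₁ (hr : 3 * r = nm) (hpos : 0 < r) : Fin nm := ⟨r, by omega⟩

/-- Auxiliary. [folklore] -/
def corner₂ (hr : 3 * r = nm) (hpos : 0 < r) : Fin nm := ⟨2 * r, by omega⟩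

/-- the chord set of a tripod picture contains the three triangle chords `(α, β)`, `(β, γ)`, `(γ, α)`. [folklore] -/
private theorem mem_chords₃ {α β γ : Fin nm} (L : Finset (Fin nm × Fin nm)) :
    (α, β) ∈ withPair (withPair (withPair L α β) β γ) γ α ∧ (β, γ) ∈ withPair (withPair (withPair L α β) β γ) γ α ∧
      (γ, α) ∈ withPair (withPair (withPair L α β) β γ) γ α :=
  ⟨mem_withPair.2 (Or.inr (Or.inr (mem_withPair.2 (Or.inr (Or.inr (mem_withPair.2 (Or.inl ⟨rfl, rfl⟩))))))),
   mem_withPair.2 (Or.inr (Or.inr (mem_withPair.2 (Or.inl ⟨rfl, rfl⟩)))), mem_withPair.2 (Or.inl ⟨rfl, rfl⟩)⟩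

/-- value-level form of the three non-crossing constraints against the triangle chords. [folklore] -/
private theorem triangle_constraints (hr : 3 * r = nm) (hpos : 0 < r) {L : Finset (Fin nm × Fin nm)}
    (hT : TripodPicture (corner₀ hr hpos) (corner₁ hr hpos) (corner₂ hr hpos) L) {u p : Fin nm} (hup : (u, p) ∈ L) :
    ¬ CcwQuad (corner₀ hr hpos) u (corner₁ hr hpos) p ∧ ¬ CcwQuad (corner₁ hr hpos) u (corner₂ hr hpos) p ∧
      ¬ CcwQuad (corner₂ hr hpos) u (corner₀ hr hpos) p := by
  obtain ⟨m01, m12, m20⟩ := mem_chords₃ (α := corner₀ hr hpos) (β := corner₁ hr hpos) (γ := corner₂ hr hpos) L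
  exact ⟨hT.planar _ u _ p m01 hup, hT.planar _ u _ p m12 hup, hT.planar _ u _ p m20 hup⟩

/-- ★ **IN A TRIPOD PICTURE ON THE TRIANGLE `(0, r, 2r)` EVERY CHORD STAYS INSIDE ONE OPEN ARC** — a chord leaving the arc `(c, c + r)`
would interleave the triangle chord joining its two corners. [cite: KhristoforovSmirnov2021, §2 Lemma 4, proof and Fig. 3 (arXiv v1 p. 4); §1.2
(p. 2: «IP(ξ) is a union of disjoint paths»)] -/
theorem arc_closed (hr : 3 * r = nm) (hpos : 0 < r) {L : Finset (Fin nm × Fin nm)}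
    (hT : TripodPicture (corner₀ hr hpos) (corner₁ hr hpos) (corner₂ hr hpos) L) {c : ℕ} (hc : c = 0 ∨ c = r ∨ c = 2 * r)
    {u p : Fin nm} (hup : (u, p) ∈ L) (hu1 : c < u.1) (hu2 : u.1 < c + r) : c < p.1 ∧ p.1 < c + r := by
  have hp := p.2
  obtain ⟨hp0, hp1, hp2⟩ := hT.off _ _ (hT.symm _ _ hup)
  have vp0 : p.1 ≠ 0 := fun e => hp0 (Fin.ext e)
  have vp1 : p.1 ≠ r := fun e => hp1 (Fin.ext e)
  have vp2 : p.1 ≠ 2 * r := fun e => hp2 (Fin.ext e)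
  obtain ⟨n01, n12, n20⟩ := triangle_constraints hr hpos hT hup
  unfold CcwQuad at n01 n12 n20
  simp only [Fin.lt_def, corner₀, corner₁, corner₂] at n01 n12 n20
  -- one triangle chord per arc (keep `omega`'s case analysis small)
  rcases hc with rfl | rfl | rfl
  · clear n12 n20; omega
  · clear n01 n20; omega
  · clear n01 n12; omega

/-! #### Rotation bookkeeping -/

/-- powers of the rotation compose additively on relations. [cite: KhristoforovSmirnov2021, §1.2 (arXiv v1 p. 2: cyclic indexing)] -/
theorem relMap_rot_pow_rot_pow (s t : ℕ) (L : Finset (Fin nm × Fin nm)) :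
    relMap (rot nm ^ s) (relMap (rot nm ^ t) L) = relMap (rot nm ^ (s + t)) L := by
  rw [← relMap_trans, pow_add, Equiv.Perm.mul_def]

/-- powers of the rotation commute on relations. [cite: KhristoforovSmirnov2021, §1.2 (arXiv v1 p. 2: cyclic indexing)] -/
theorem relMap_rot_pow_comm (s t : ℕ) (L : Finset (Fin nm × Fin nm)) :
    relMap (rot nm ^ s) (relMap (rot nm ^ t) L) = relMap (rot nm ^ t) (relMap (rot nm ^ s) L) := by
  rw [relMap_rot_pow_rot_pow, relMap_rot_pow_rot_pow, add_comm]

/-- a full turn does nothing to a relation. [cite: KhristoforovSmirnov2021, §1.2 (arXiv v1 p. 2: cyclic indexing)] -/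
theorem relMap_rot_pow_self (L : Finset (Fin nm × Fin nm)) : relMap (rot nm ^ nm) L = L := by
  rw [rot_pow_self]; exact relMap_refl L

/-- the value of `rot^s x` when no wrap-around occurs. [cite: KhristoforovSmirnov2021, §1.2 (arXiv v1 p. 2: cyclic indexing)] -/
theorem val_rot_pow_of_lt {s : ℕ} {x : Fin nm} (h : x.1 + s < nm) : (((rot nm ^ s) x : Fin nm) : ℕ) = x.1 + s := by
  rw [val_rot_pow, Nat.mod_eq_of_lt h]

/-- the value of `rot^s x` after exactly one wrap-around. [cite: KhristoforovSmirnov2021, §1.2 (arXiv v1 p. 2: cyclic indexing)] -/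
theorem val_rot_pow_of_ge {s : ℕ} {x : Fin nm} (h1 : nm ≤ x.1 + s) (h2 : x.1 + s < nm + nm) :
    (((rot nm ^ s) x : Fin nm) : ℕ) = x.1 + s - nm := by
  rw [val_rot_pow]
  have e : x.1 + s = nm + (x.1 + s - nm) := by omega
  rw [e, Nat.add_mod_left, Nat.mod_eq_of_lt (by omega)]
  omega

/-! #### Three translated copies of a link pattern of `r − 1` points -/

/-- the first open arc `(0, r)`. [folklore] -/
def arc₀ (hr : 3 * r = nm) : Fin (r - 1) → Fin nm := arcEmb 0 (by omega)

/-- the second open arc `(r, 2r)`. [folklore] -/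
def arc₁ (hr : 3 * r = nm) : Fin (r - 1) → Fin nm := arcEmb r (by omega)

/-- the third open arc `(2r, 3r)`. [folklore] -/
def arc₂ (hr : 3 * r = nm) : Fin (r - 1) → Fin nm := arcEmb (2 * r) (by omega)

/-- values on the three arcs. [folklore] -/
@[simp] private theorem val_arc₀ (hr : 3 * r = nm) (x : Fin (r - 1)) : (arc₀ hr x).1 = 0 + 1 + x.1 := rfl

/-- Auxiliary. [folklore] -/
@[simp] private theorem val_arc₁ (hr : 3 * r = nm) (x : Fin (r - 1)) : (arc₁ hr x).1 = r + 1 + x.1 := rfl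

/-- Auxiliary. [folklore] -/
@[simp] private theorem val_arc₂ (hr : 3 * r = nm) (x : Fin (r - 1)) : (arc₂ hr x).1 = 2 * r + 1 + x.1 := rfl

/-- the arcs are increasing re-indexings. [folklore] -/
private theorem strictMono_arc₀ (hr : 3 * r = nm) : StrictMono (arc₀ hr) := strictMono_arcEmb _

/-- Auxiliary. [folklore] -/
private theorem strictMono_arc₁ (hr : 3 * r = nm) : StrictMono (arc₁ hr) := strictMono_arcEmb _

/-- Auxiliary. [folklore] -/
private theorem strictMono_arc₂ (hr : 3 * r = nm) : StrictMono (arc₂ hr) := strictMono_arcEmb _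

/-- ranges of the three arcs. [folklore] -/
private theorem arc₀_bounds (hr : 3 * r = nm) (x : Fin (r - 1)) : 0 < (arc₀ hr x).1 ∧ (arc₀ hr x).1 < r := by
  have := x.2; simp only [val_arc₀]; omega

/-- Auxiliary. [folklore] -/
private theorem arc₁_bounds (hr : 3 * r = nm) (x : Fin (r - 1)) : r < (arc₁ hr x).1 ∧ (arc₁ hr x).1 < 2 * r := by
  have := x.2; simp only [val_arc₁]; omega

/-- Auxiliary. [folklore] -/
private theorem arc₂_bounds (hr : 3 * r = nm) (x : Fin (r - 1)) : 2 * r < (arc₂ hr x).1 ∧ (arc₂ hr x).1 < 3 * r := by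
  have := x.2; simp only [val_arc₂]; omega

/-- every point of the first open arc is re-indexed. [folklore] -/
private theorem exists_arc₀_eq (hr : 3 * r = nm) {x : Fin nm} (h1 : 0 < x.1) (h2 : x.1 < r) : ∃ a, arc₀ hr a = x :=
  exists_arcEmb_eq _ (by omega) (by omega)

/-- Auxiliary. [folklore] -/
private theorem exists_arc₁_eq (hr : 3 * r = nm) {x : Fin nm} (h1 : r < x.1) (h2 : x.1 < 2 * r) : ∃ a, arc₁ hr a = x :=
  exists_arcEmb_eq _ h1 (by omega)

/-- Auxiliary. [folklore] -/
private theorem exists_arc₂_eq (hr : 3 * r = nm) {x : Fin nm} (h1 : 2 * r < x.1) : ∃ a, arc₂ hr a = x :=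
  exists_arcEmb_eq _ h1 (by have := x.2; omega)

/-- the rotation `rot^r` carries the first arc to the second … [cite: KhristoforovSmirnov2021, §1.2 (arXiv v1 p. 2: cyclic indexing)] -/
theorem rot_pow_arc₀ (hr : 3 * r = nm) (x : Fin (r - 1)) : (rot nm ^ r) (arc₀ hr x) = arc₁ hr x :=
  Fin.ext (by have := x.2; rw [val_rot_pow_of_lt (by simp only [val_arc₀]; omega)]; simp only [val_arc₀, val_arc₁]; omega)

/-- … the second to the third … [cite: KhristoforovSmirnov2021, §1.2 (arXiv v1 p. 2: cyclic indexing)] -/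
theorem rot_pow_arc₁ (hr : 3 * r = nm) (x : Fin (r - 1)) : (rot nm ^ r) (arc₁ hr x) = arc₂ hr x :=
  Fin.ext (by have := x.2; rw [val_rot_pow_of_lt (by simp only [val_arc₁]; omega)]; simp only [val_arc₁, val_arc₂]; omega)

/-- … and the third back to the first. [cite: KhristoforovSmirnov2021, §1.2 (arXiv v1 p. 2: cyclic indexing)] -/
theorem rot_pow_arc₂ (hr : 3 * r = nm) (x : Fin (r - 1)) : (rot nm ^ r) (arc₂ hr x) = arc₀ hr x :=
  Fin.ext (by
    have := x.2
    rw [val_rot_pow_of_ge (by simp only [val_arc₂]; omega) (by simp only [val_arc₂]; omega)]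
    simp only [val_arc₂, val_arc₀]; omega)

/-- **THREE TRANSLATED COPIES** of a relation `A` on `r − 1` points, one on each open arc of the triangle `(0, r, 2r)`.
[cite: KhristoforovSmirnov2021, §2 Lemma 4, proof and Fig. 3 (arXiv v1 p. 4)] -/
def glue₃ (hr : 3 * r = nm) (A : Finset (Fin (r - 1) × Fin (r - 1))) : Finset (Fin nm × Fin nm) :=
  A.image (Prod.map (arc₀ hr) (arc₀ hr)) ∪ (A.image (Prod.map (arc₁ hr) (arc₁ hr)) ∪ A.image (Prod.map (arc₂ hr) (arc₂ hr)))

/-- membership in the three copies (auxiliary). [cite: KhristoforovSmirnov2021, §2 Lemma 4, proof and Fig. 3 (arXiv v1 p. 4)] -/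
theorem mem_glue₃ {hr : 3 * r = nm} {A : Finset (Fin (r - 1) × Fin (r - 1))} {x z : Fin nm} : (x, z) ∈ glue₃ hr A ↔
    (∃ a c, (a, c) ∈ A ∧ arc₀ hr a = x ∧ arc₀ hr c = z) ∨ (∃ a c, (a, c) ∈ A ∧ arc₁ hr a = x ∧ arc₁ hr c = z) ∨
      (∃ a c, (a, c) ∈ A ∧ arc₂ hr a = x ∧ arc₂ hr c = z) := by
  simp only [glue₃, mem_union, mem_image, Prod.exists, Prod.map_apply, Prod.mk.injEq]

/-- the values of a glued chord: both ends in the same open arc. [folklore] -/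
private theorem glue₃_vals {hr : 3 * r = nm} {A : Finset (Fin (r - 1) × Fin (r - 1))} {x z : Fin nm} (h : (x, z) ∈ glue₃ hr A) :
    (0 < x.1 ∧ x.1 < r ∧ 0 < z.1 ∧ z.1 < r) ∨ (r < x.1 ∧ x.1 < 2 * r ∧ r < z.1 ∧ z.1 < 2 * r) ∨ (2 * r < x.1 ∧ 2 * r < z.1) := by
  rcases mem_glue₃.1 h with ⟨a, c, -, rfl, rfl⟩ | ⟨a, c, -, rfl, rfl⟩ | ⟨a, c, -, rfl, rfl⟩
  · have := a.2; have := c.2; simp only [val_arc₀]; omega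
  · have := a.2; have := c.2; simp only [val_arc₁]; omega
  · have := a.2; have := c.2; simp only [val_arc₂]; omega

/-- ★ **THREE TRANSLATED COPIES OF A LINK PATTERN FORM A TRIPOD PICTURE ON THE TRIANGLE `(0, r, 2r)`** (chords in different arcs, or an arc
chord and a triangle chord, never interleave). [cite: KhristoforovSmirnov2021, §2 Lemma 4, proof and Fig. 3 (arXiv v1 p. 4); §1.2 (p. 2)] -/
theorem tripodPicture_glue₃ (hr : 3 * r = nm) (hpos : 0 < r) {A : Finset (Fin (r - 1) × Fin (r - 1))} (hA : IsNCMatching A) :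
    TripodPicture (corner₀ hr hpos) (corner₁ hr hpos) (corner₂ hr hpos) (glue₃ hr A) := by
  have inj₀ := (strictMono_arc₀ hr).injective
  have inj₁ := (strictMono_arc₁ hr).injective
  have inj₂ := (strictMono_arc₂ hr).injective
  refine ⟨?_, fun x z h => ?_, fun x h => ?_, fun x z h => ?_, fun x h0 h1 h2 => ?_, fun x y z w hxz hyw hq => ?_⟩
  · -- ccw
    left
    simp only [Fin.lt_def, corner₀, corner₁, corner₂]
    omega
  · -- symmetric
    rcases mem_glue₃.1 h with ⟨a, c, hac, rfl, rfl⟩ | ⟨a, c, hac, rfl, rfl⟩ | ⟨a, c, hac, rfl, rfl⟩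
    · exact mem_glue₃.2 (Or.inl ⟨c, a, hA.symm _ _ hac, rfl, rfl⟩)
    · exact mem_glue₃.2 (Or.inr (Or.inl ⟨c, a, hA.symm _ _ hac, rfl, rfl⟩))
    · exact mem_glue₃.2 (Or.inr (Or.inr ⟨c, a, hA.symm _ _ hac, rfl, rfl⟩))
  · -- irreflexive
    rcases mem_glue₃.1 h with ⟨a, c, hac, ha, hc⟩ | ⟨a, c, hac, ha, hc⟩ | ⟨a, c, hac, ha, hc⟩
    · rw [inj₀ (ha.trans hc.symm)] at hac; exact hA.irrefl _ hac
    · rw [inj₁ (ha.trans hc.symm)] at hac; exact hA.irrefl _ hac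
    · rw [inj₂ (ha.trans hc.symm)] at hac; exact hA.irrefl _ hac
  · -- off the corners
    have hv := glue₃_vals h
    refine ⟨fun e => ?_, fun e => ?_, fun e => ?_⟩ <;> have := congrArg Fin.val e <;>
      simp only [corner₀, corner₁, corner₂] at this <;> omega
  · -- perfect
    have v0 : x.1 ≠ 0 := fun e => h0 (Fin.ext e)
    have v1 : x.1 ≠ r := fun e => h1 (Fin.ext e)
    have v2 : x.1 ≠ 2 * r := fun e => h2 (Fin.ext e)
    have hx := x.2
    by_cases hx0 : x.1 < r
    · obtain ⟨a, rfl⟩ := exists_arc₀_eq hr (x := x) (by omega) hx0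
      obtain ⟨c, hc, hu⟩ := hA.perfect a
      refine ⟨arc₀ hr c, mem_glue₃.2 (Or.inl ⟨a, c, hc, rfl, rfl⟩), fun z hz => ?_⟩
      rcases mem_glue₃.1 hz with ⟨a', c', hac', ha', rfl⟩ | ⟨a', c', -, ha', -⟩ | ⟨a', c', -, ha', -⟩
      · rw [inj₀ ha'] at hac'; rw [hu _ hac']
      · exact absurd (congrArg Fin.val ha') (by have := a.2; have := a'.2; simp only [val_arc₁, val_arc₀]; omega)
      · exact absurd (congrArg Fin.val ha') (by have := a.2; have := a'.2; simp only [val_arc₂, val_arc₀]; omega)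
    by_cases hx1 : x.1 < 2 * r
    · obtain ⟨a, rfl⟩ := exists_arc₁_eq hr (x := x) (by omega) hx1
      obtain ⟨c, hc, hu⟩ := hA.perfect a
      refine ⟨arc₁ hr c, mem_glue₃.2 (Or.inr (Or.inl ⟨a, c, hc, rfl, rfl⟩)), fun z hz => ?_⟩
      rcases mem_glue₃.1 hz with ⟨a', c', -, ha', -⟩ | ⟨a', c', hac', ha', rfl⟩ | ⟨a', c', -, ha', -⟩
      · exact absurd (congrArg Fin.val ha') (by have := a.2; have := a'.2; simp only [val_arc₀, val_arc₁]; omega)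
      · rw [inj₁ ha'] at hac'; rw [hu _ hac']
      · exact absurd (congrArg Fin.val ha') (by have := a.2; have := a'.2; simp only [val_arc₂, val_arc₁]; omega)
    · obtain ⟨a, rfl⟩ := exists_arc₂_eq hr (x := x) (by omega)
      obtain ⟨c, hc, hu⟩ := hA.perfect a
      refine ⟨arc₂ hr c, mem_glue₃.2 (Or.inr (Or.inr ⟨a, c, hc, rfl, rfl⟩)), fun z hz => ?_⟩
      rcases mem_glue₃.1 hz with ⟨a', c', -, ha', -⟩ | ⟨a', c', -, ha', -⟩ | ⟨a', c', hac', ha', rfl⟩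
      · exact absurd (congrArg Fin.val ha') (by have := a.2; have := a'.2; simp only [val_arc₀, val_arc₂]; omega)
      · exact absurd (congrArg Fin.val ha') (by have := a.2; have := a'.2; simp only [val_arc₁, val_arc₂]; omega)
      · rw [inj₂ ha'] at hac'; rw [hu _ hac']
  · -- planar
    have vq := hq
    unfold CcwQuad at vq
    simp only [Fin.lt_def] at vq
    have hv := glue₃_vals hyw
    rw [mem_withPair, mem_withPair, mem_withPair] at hxz
    rcases hxz with ⟨rfl, rfl⟩ | ⟨rfl, rfl⟩ | ⟨rfl, rfl⟩ | ⟨rfl, rfl⟩ | ⟨rfl, rfl⟩ | ⟨rfl, rfl⟩ | hxz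
    · simp only [corner₀, corner₂] at vq; omega
    · simp only [corner₀, corner₂] at vq; omega
    · simp only [corner₁, corner₂] at vq; omega
    · simp only [corner₁, corner₂] at vq; omega
    · simp only [corner₀, corner₁] at vq; omega
    · simp only [corner₀, corner₁] at vq; omega
    · clear hv
      rcases mem_glue₃.1 hxz with ⟨a, c, hac, rfl, rfl⟩ | ⟨a, c, hac, rfl, rfl⟩ | ⟨a, c, hac, rfl, rfl⟩ <;>
        rcases mem_glue₃.1 hyw with ⟨a', c', hac', rfl, rfl⟩ | ⟨a', c', hac', rfl, rfl⟩ | ⟨a', c', hac', rfl, rfl⟩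
      · exact hA.planar _ _ _ _ hac hac' ((ccwQuad_iff_of_strictMono₃ (strictMono_arc₀ hr)).1 hq)
      · have := a.2; have := c.2; have := a'.2; have := c'.2; simp only [val_arc₀, val_arc₁] at vq; omega
      · have := a.2; have := c.2; have := a'.2; have := c'.2; simp only [val_arc₀, val_arc₂] at vq; omega
      · have := a.2; have := c.2; have := a'.2; have := c'.2; simp only [val_arc₀, val_arc₁] at vq; omega
      · exact hA.planar _ _ _ _ hac hac' ((ccwQuad_iff_of_strictMono₃ (strictMono_arc₁ hr)).1 hq)
      · have := a.2; have := c.2; have := a'.2; have := c'.2; simp only [val_arc₁, val_arc₂] at vq; omega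
      · have := a.2; have := c.2; have := a'.2; have := c'.2; simp only [val_arc₀, val_arc₂] at vq; omega
      · have := a.2; have := c.2; have := a'.2; have := c'.2; simp only [val_arc₁, val_arc₂] at vq; omega
      · exact hA.planar _ _ _ _ hac hac' ((ccwQuad_iff_of_strictMono₃ (strictMono_arc₂ hr)).1 hq)

/-- ★ **THE THREE COPIES ARE `rot^r`-INVARIANT** (the rotation carries arc to arc). [cite: KhristoforovSmirnov2021, §1.2 (arXiv v1 p. 2: cyclic
indexing); §2 Lemma 4, Fig. 3 (p. 4)] -/
theorem relMap_rot_pow_glue₃ (hr : 3 * r = nm) (A : Finset (Fin (r - 1) × Fin (r - 1))) :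
    relMap (rot nm ^ r) (glue₃ hr A) = glue₃ hr A := by
  symm
  apply Finset.eq_of_subset_of_card_le
  · rintro ⟨x, z⟩ h
    rcases mem_glue₃.1 h with ⟨a, c, hac, rfl, rfl⟩ | ⟨a, c, hac, rfl, rfl⟩ | ⟨a, c, hac, rfl, rfl⟩
    · rw [← rot_pow_arc₂, ← rot_pow_arc₂]
      exact mem_relMap_apply.2 (mem_glue₃.2 (Or.inr (Or.inr ⟨a, c, hac, rfl, rfl⟩)))
    · rw [← rot_pow_arc₀, ← rot_pow_arc₀]
      exact mem_relMap_apply.2 (mem_glue₃.2 (Or.inl ⟨a, c, hac, rfl, rfl⟩))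
    · rw [← rot_pow_arc₁, ← rot_pow_arc₁]
      exact mem_relMap_apply.2 (mem_glue₃.2 (Or.inr (Or.inl ⟨a, c, hac, rfl, rfl⟩)))
  · unfold relMap
    rw [Finset.card_map]

/-! #### An invariant relation on the base triangle is determined by its first arc -/

/-- **the invariant tripod relations on the base triangle** `(0, r, 2r)`. [cite: KhristoforovSmirnov2021, §2 Lemma 4, proof and Fig. 3
(arXiv v1 p. 4)] -/
def BaseRel (hr : 3 * r = nm) (hpos : 0 < r) : Type :=
  {L : Finset (Fin nm × Fin nm) // TripodPicture (corner₀ hr hpos) (corner₁ hr hpos) (corner₂ hr hpos) L ∧ relMap (rot nm ^ r) L = L}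

/-- ★ **THE FIRST ARC OF AN INVARIANT TRIPOD RELATION IS A LINK PATTERN OF `r − 1` POINTS.** [cite: KhristoforovSmirnov2021, §1.2 (arXiv v1
p. 2: the link pattern); §2 Lemma 4, Fig. 3 (p. 4)] -/
theorem isNCMatching_pullRel_arc₀ (hr : 3 * r = nm) (hpos : 0 < r) {L : Finset (Fin nm × Fin nm)}
    (hT : TripodPicture (corner₀ hr hpos) (corner₁ hr hpos) (corner₂ hr hpos) L) : IsNCMatching (pullRel (arc₀ hr) L) := by
  have inj₀ := (strictMono_arc₀ hr).injective
  refine ⟨fun a b h => ?_, fun a h => ?_, fun a => ?_, fun x y z w hxz hyw hq => ?_⟩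
  · rw [mem_pullRel] at h ⊢; exact hT.symm _ _ h
  · rw [mem_pullRel] at h; exact hT.irrefl _ h
  · have ha := arc₀_bounds hr a
    obtain ⟨b, hb, hu⟩ := hT.perfect (arc₀ hr a)
      (fun e => by have := congrArg Fin.val e; simp only [corner₀] at this; omega)
      (fun e => by have := congrArg Fin.val e; simp only [corner₁] at this; omega)
      (fun e => by have := congrArg Fin.val e; simp only [corner₂] at this; omega)
    obtain ⟨hb1, hb2⟩ := arc_closed hr hpos hT (Or.inl rfl) hb ha.1 (by omega)
    obtain ⟨c, rfl⟩ := exists_arc₀_eq hr (x := b) hb1 (by omega)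
    exact ⟨c, mem_pullRel.2 hb, fun c' hc' => inj₀ (hu _ (mem_pullRel.1 hc'))⟩
  · rw [mem_pullRel] at hxz hyw
    exact hT.planar _ _ _ _ (mem_withPair.2 (Or.inr (Or.inr (mem_withPair.2 (Or.inr (Or.inr (mem_withPair.2 (Or.inr (Or.inr hxz)))))))))
      hyw ((ccwQuad_iff_of_strictMono₃ (strictMono_arc₀ hr)).2 hq)

/-- ★★ **AN INVARIANT TRIPOD RELATION ON THE BASE TRIANGLE IS DETERMINED BY ITS FIRST ARC, which can be any link pattern of `r − 1`
points.** [cite: KhristoforovSmirnov2021, §2 Lemma 4, proof and Fig. 3 (arXiv v1 p. 4); §1.2 (p. 2)] -/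
noncomputable def baseEquiv (hr : 3 * r = nm) (hpos : 0 < r) : BaseRel hr hpos ≃ NCMatching (r - 1) where
  toFun L := ⟨pullRel (arc₀ hr) L.1, isNCMatching_pullRel_arc₀ hr hpos L.2.1⟩
  invFun A := ⟨glue₃ hr A.1, tripodPicture_glue₃ hr hpos A.2, relMap_rot_pow_glue₃ hr A.1⟩
  left_inv L := by
    obtain ⟨L, hT, hinv⟩ := L
    apply Subtype.ext
    show glue₃ hr (pullRel (arc₀ hr) L) = L
    ext ⟨x, z⟩
    rw [mem_glue₃]
    constructor
    · rintro (⟨a, c, hac, rfl, rfl⟩ | ⟨a, c, hac, rfl, rfl⟩ | ⟨a, c, hac, rfl, rfl⟩)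
      · exact mem_pullRel.1 hac
      · rw [← rot_pow_arc₀, ← rot_pow_arc₀, ← hinv]
        exact mem_relMap_apply.2 (mem_pullRel.1 hac)
      · rw [← rot_pow_arc₁, ← rot_pow_arc₁, ← hinv, ← rot_pow_arc₀, ← rot_pow_arc₀]
        refine mem_relMap_apply.2 ?_
        rw [← hinv]
        exact mem_relMap_apply.2 (mem_pullRel.1 hac)
    · intro h
      obtain ⟨hx0, hx1, hx2⟩ := hT.off _ _ h
      have v0 : x.1 ≠ 0 := fun e => hx0 (Fin.ext e)
      have v1 : x.1 ≠ r := fun e => hx1 (Fin.ext e)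
      have v2 : x.1 ≠ 2 * r := fun e => hx2 (Fin.ext e)
      have hx := x.2
      by_cases c0 : x.1 < r
      · obtain ⟨hz1, hz2⟩ := arc_closed hr hpos hT (Or.inl rfl) h (by omega) (by omega)
        obtain ⟨a, rfl⟩ := exists_arc₀_eq hr (x := x) (by omega) c0
        obtain ⟨c, rfl⟩ := exists_arc₀_eq hr (x := z) hz1 (by omega)
        exact Or.inl ⟨a, c, mem_pullRel.2 h, rfl, rfl⟩
      by_cases c1 : x.1 < 2 * r
      · obtain ⟨hz1, hz2⟩ := arc_closed hr hpos hT (Or.inr (Or.inl rfl)) h (by omega) (by omega)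
        obtain ⟨a, ha⟩ := exists_arc₁_eq hr (x := x) (by omega) c1
        obtain ⟨c, hc⟩ := exists_arc₁_eq hr (x := z) hz1 (by omega)
        refine Or.inr (Or.inl ⟨a, c, mem_pullRel.2 ?_, ha, hc⟩)
        rw [← ha, ← hc] at h
        change ((arc₁ hr a, arc₁ hr c) ∈ L) at h
        rw [← rot_pow_arc₀, ← rot_pow_arc₀, ← hinv] at h
        exact mem_relMap_apply.1 h
      · obtain ⟨hz1, hz2⟩ := arc_closed hr hpos hT (Or.inr (Or.inr rfl)) h (by omega) (by omega)
        obtain ⟨a, ha⟩ := exists_arc₂_eq hr (x := x) (by omega)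
        obtain ⟨c, hc⟩ := exists_arc₂_eq hr (x := z) hz1
        refine Or.inr (Or.inr ⟨a, c, mem_pullRel.2 ?_, ha, hc⟩)
        rw [← ha, ← hc] at h
        change ((arc₂ hr a, arc₂ hr c) ∈ L) at h
        rw [← rot_pow_arc₁, ← rot_pow_arc₁, ← hinv] at h
        have h' := mem_relMap_apply.1 h
        rw [← rot_pow_arc₀, ← rot_pow_arc₀, ← hinv] at h'
        exact mem_relMap_apply.1 h'
  right_inv A := by
    obtain ⟨A, hA⟩ := A
    apply Subtype.ext
    show pullRel (arc₀ hr) (glue₃ hr A) = A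
    ext ⟨a, c⟩
    rw [mem_pullRel, mem_glue₃]
    constructor
    · rintro (⟨a', c', hac', ha', hc'⟩ | ⟨a', c', -, ha', -⟩ | ⟨a', c', -, ha', -⟩)
      · have inj₀ := (strictMono_arc₀ hr).injective
        have ea : a' = a := inj₀ ha'
        have ec : c' = c := inj₀ hc'
        subst ea ec; exact hac'
      · exact absurd (congrArg Fin.val ha') (by have := a.2; have := a'.2; simp only [val_arc₁, val_arc₀]; omega)
      · exact absurd (congrArg Fin.val ha') (by have := a.2; have := a'.2; simp only [val_arc₂, val_arc₀]; omega)
    · exact fun h => Or.inl ⟨a, c, h, rfl, rfl⟩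

/-! #### Rotating the apex back: every invariant triangle comes from the base triangle -/

/-- **the invariant triangle pictures**: apexes `(α, α + r, α + 2r)` and a `rot^r`-invariant relation — REP's characterisation of the pictures
fixed by `Pic.shift` along `rot^r`. [cite: KhristoforovSmirnov2021, §2 Lemma 4, proof and Fig. 3 (arXiv v1 p. 4); §1.2 (p. 2: cyclic indexing)] -/
abbrev IsInvTri (r : ℕ) (P : Pic nm) : Prop := P.β.val = P.α.val + r ∧ P.γ.val = P.α.val + 2 * r ∧ relMap (rot nm ^ r) P.L₀ = P.L₀

/-- the apex of an invariant triangle is below `r`. [folklore] -/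
private theorem apex_lt (hr : 3 * r = nm) {P : Pic nm} (h : IsInvTri r P) : P.α.val < r := by
  have := P.γ.2; have := h.2.1; omega

/-- values of the rotated corners `rot^a 0 = a`, `rot^a r = r + a`, `rot^a (2r) = 2r + a` (`a < r`). [cite: KhristoforovSmirnov2021, §1.2
(arXiv v1 p. 2: cyclic indexing)] -/
private theorem val_rot_pow_corners (hr : 3 * r = nm) (hpos : 0 < r) (a : Fin r) :
    (((rot nm ^ a.1) (corner₀ hr hpos) : Fin nm) : ℕ) = 0 + a.1 ∧ (((rot nm ^ a.1) (corner₁ hr hpos) : Fin nm) : ℕ) = r + a.1 ∧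
      (((rot nm ^ a.1) (corner₂ hr hpos) : Fin nm) : ℕ) = 2 * r + a.1 := by
  have := a.2
  exact ⟨val_rot_pow_of_lt (x := corner₀ hr hpos) (by show 0 + a.1 < nm; omega),
    val_rot_pow_of_lt (x := corner₁ hr hpos) (by show r + a.1 < nm; omega),
    val_rot_pow_of_lt (x := corner₂ hr hpos) (by show 2 * r + a.1 < nm; omega)⟩

/-- **rotating a base relation to apex `a`**: the picture `(a, a + r, a + 2r; rot^a L₀)`. [cite: KhristoforovSmirnov2021, §1.2 (arXiv v1 p. 2:
cyclic indexing); §2 Lemma 4, Fig. 3 (p. 4)] -/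
noncomputable def rotPic (hr : 3 * r = nm) (hpos : 0 < r) (a : Fin r) (L : BaseRel hr hpos) : {P : Pic nm // IsInvTri r P} :=
  ⟨⟨(((rot nm ^ a.1) (corner₀ hr hpos), (rot nm ^ a.1) (corner₁ hr hpos), (rot nm ^ a.1) (corner₂ hr hpos)), relMap (rot nm ^ a.1) L.1),
    by rw [Fin.lt_def, (val_rot_pow_corners hr hpos a).1, (val_rot_pow_corners hr hpos a).2.1]; omega,
    by rw [Fin.lt_def, (val_rot_pow_corners hr hpos a).2.1, (val_rot_pow_corners hr hpos a).2.2]; omega,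
    L.2.1.map (isCyc_rot_pow a.1)⟩,
   by
    show (((rot nm ^ a.1) (corner₁ hr hpos) : Fin nm) : ℕ) = (((rot nm ^ a.1) (corner₀ hr hpos) : Fin nm) : ℕ) + r
    rw [(val_rot_pow_corners hr hpos a).1, (val_rot_pow_corners hr hpos a).2.1]; omega,
   by
    show (((rot nm ^ a.1) (corner₂ hr hpos) : Fin nm) : ℕ) = (((rot nm ^ a.1) (corner₀ hr hpos) : Fin nm) : ℕ) + 2 * r
    rw [(val_rot_pow_corners hr hpos a).1, (val_rot_pow_corners hr hpos a).2.2]; omega,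
   by
    show relMap (rot nm ^ r) (relMap (rot nm ^ a.1) L.1) = relMap (rot nm ^ a.1) L.1
    rw [relMap_rot_pow_comm, L.2.2]⟩

/-- the apex of the rotated picture. [folklore] -/
@[simp] private theorem rotPic_α (hr : 3 * r = nm) (hpos : 0 < r) (a : Fin r) (L : BaseRel hr hpos) :
    (rotPic hr hpos a L).1.α = (rot nm ^ a.1) (corner₀ hr hpos) := rfl

/-- the relation of the rotated picture. [folklore] -/
@[simp] private theorem rotPic_L₀ (hr : 3 * r = nm) (hpos : 0 < r) (a : Fin r) (L : BaseRel hr hpos) :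
    (rotPic hr hpos a L).1.L₀ = relMap (rot nm ^ a.1) L.1 := rfl

/-- `rot^(k − α)` carries the apexes of an invariant triangle to the corners `(0, r, 2r)`. [cite: KhristoforovSmirnov2021, §1.2 (arXiv v1 p. 2:
cyclic indexing)] -/
private theorem rot_pow_apexes (hr : 3 * r = nm) (hpos : 0 < r) (P : {P : Pic nm // IsInvTri r P}) :
    (rot nm ^ (nm - P.1.α.val)) P.1.α = corner₀ hr hpos ∧ (rot nm ^ (nm - P.1.α.val)) P.1.β = corner₁ hr hpos ∧
      (rot nm ^ (nm - P.1.α.val)) P.1.γ = corner₂ hr hpos := by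
  have ha := apex_lt hr P.2
  have hb := P.2.1
  have hc := P.2.2.1
  exact ⟨Fin.ext (by rw [val_rot_pow_of_ge (by omega) (by omega)]; simp only [corner₀]; omega),
    Fin.ext (by rw [val_rot_pow_of_ge (by omega) (by omega)]; simp only [corner₁]; omega),
    Fin.ext (by rw [val_rot_pow_of_ge (by omega) (by omega)]; simp only [corner₂]; omega)⟩

/-- the transported picture sits on the base triangle. [cite: KhristoforovSmirnov2021, §2 Lemma 4, proof and Fig. 3 (arXiv v1 p. 4)] -/
private theorem tripodPicture_basePart (hr : 3 * r = nm) (hpos : 0 < r) (P : {P : Pic nm // IsInvTri r P}) :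
    TripodPicture (corner₀ hr hpos) (corner₁ hr hpos) (corner₂ hr hpos) (relMap (rot nm ^ (nm - P.1.α.val)) P.1.L₀) := by
  obtain ⟨e0, e1, e2⟩ := rot_pow_apexes hr hpos P
  have h := P.1.pic.map (isCyc_rot_pow (nm - P.1.α.val))
  rw [e0, e1, e2] at h
  exact h

/-- **rotating an invariant triangle back to the base**: `rot^(k − α)` carries the apexes to `(0, r, 2r)`. [cite: KhristoforovSmirnov2021, §1.2
(arXiv v1 p. 2: cyclic indexing); §2 Lemma 4, Fig. 3 (p. 4)] -/
noncomputable def basePart (hr : 3 * r = nm) (hpos : 0 < r) (P : {P : Pic nm // IsInvTri r P}) : BaseRel hr hpos :=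
  ⟨relMap (rot nm ^ (nm - P.1.α.val)) P.1.L₀, tripodPicture_basePart hr hpos P, by rw [relMap_rot_pow_comm, P.2.2.2]⟩

/-- the relation of the base part. [folklore] -/
@[simp] private theorem basePart_val (hr : 3 * r = nm) (hpos : 0 < r) (P : {P : Pic nm // IsInvTri r P}) :
    (basePart hr hpos P).1 = relMap (rot nm ^ (nm - P.1.α.val)) P.1.L₀ := rfl

/-- ★★ **THE INVARIANT TRIANGLES ARE THE ROTATED BASE RELATIONS**: `(apex, base relation) ↦` picture is a bijection
`Fin r × BaseRel ≃ {invariant triangle pictures}`. [cite: KhristoforovSmirnov2021, §2 Lemma 4, proof and Fig. 3 (arXiv v1 p. 4); §1.2 (p. 2)] -/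
noncomputable def invTriEquiv (hr : 3 * r = nm) (hpos : 0 < r) : {P : Pic nm // IsInvTri r P} ≃ Fin r × BaseRel hr hpos where
  toFun P := (⟨P.1.α.val, apex_lt hr P.2⟩, basePart hr hpos P)
  invFun q := rotPic hr hpos q.1 q.2
  left_inv P := by
    have ha := apex_lt hr P.2
    have hb := P.2.1
    have hc := P.2.2.1
    have hk : P.1.α.val + (nm - P.1.α.val) = nm := by omega
    -- the four components of the picture
    have eα : (rot nm ^ P.1.α.val) (corner₀ hr hpos) = P.1.α :=
      Fin.ext (by rw [val_rot_pow_of_lt (by simp only [corner₀]; omega)]; simp only [corner₀]; omega)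
    have eβ : (rot nm ^ P.1.α.val) (corner₁ hr hpos) = P.1.β :=
      Fin.ext (by rw [val_rot_pow_of_lt (by simp only [corner₁]; omega)]; simp only [corner₁]; omega)
    have eγ : (rot nm ^ P.1.α.val) (corner₂ hr hpos) = P.1.γ :=
      Fin.ext (by rw [val_rot_pow_of_lt (by simp only [corner₂]; omega)]; simp only [corner₂]; omega)
    have eL : relMap (rot nm ^ P.1.α.val) (relMap (rot nm ^ (nm - P.1.α.val)) P.1.L₀) = P.1.L₀ := by
      rw [relMap_rot_pow_rot_pow, hk, relMap_rot_pow_self]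
    apply Subtype.ext
    apply Subtype.ext
    change ((((rot nm ^ P.1.α.val) (corner₀ hr hpos), (rot nm ^ P.1.α.val) (corner₁ hr hpos), (rot nm ^ P.1.α.val) (corner₂ hr hpos)),
      relMap (rot nm ^ P.1.α.val) (relMap (rot nm ^ (nm - P.1.α.val)) P.1.L₀)) : (Fin nm × Fin nm × Fin nm) × Finset (Fin nm × Fin nm)) =
        P.1.1
    rw [eα, eβ, eγ, eL]
    rfl
  right_inv q := by
    obtain ⟨a, L⟩ := q
    have ha := a.2
    have hk : (nm - (0 + a.1)) + a.1 = nm := by omega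
    have eα : (((rot nm ^ a.1) (corner₀ hr hpos) : Fin nm) : ℕ) = 0 + a.1 := (val_rot_pow_corners hr hpos a).1
    apply Prod.ext
    · apply Fin.ext
      change (((rot nm ^ a.1) (corner₀ hr hpos) : Fin nm) : ℕ) = a.1
      rw [eα]; omega
    · apply Subtype.ext
      change relMap (rot nm ^ (nm - (((rot nm ^ a.1) (corner₀ hr hpos) : Fin nm) : ℕ))) (relMap (rot nm ^ a.1) L.1) = L.1
      rw [eα, relMap_rot_pow_rot_pow, hk, relMap_rot_pow_self]

/-! #### The count -/

/-- ★★★ **THE NUMBER OF INVARIANT TRIANGLE PICTURES IS `r · #NCMatching (r − 1)`** (`k = 3r`): the apex is any of the `r` points below `r` and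
the relation is three translated copies of any link pattern of the `r − 1` points of one open arc.
[cite: KhristoforovSmirnov2021, §2 Lemma 4, proof and Fig. 3 (arXiv v1 p. 4); §1.2 (p. 2: cyclic indexing, the link pattern)] -/
theorem card_isInvTri (hr : 3 * r = nm) (hpos : 0 < r) :
    Fintype.card {P : Pic nm // IsInvTri r P} = r * Fintype.card (NCMatching (r - 1)) := by
  rw [Fintype.card_congr ((invTriEquiv hr hpos).trans (Equiv.prodCongr (Equiv.refl _) (baseEquiv hr hpos))), Fintype.card_prod,
    Fintype.card_fin]

/-- ★★★ **REP's COUNT TYPED**: the number of pictures fixed by the re-ordered transport along `rot^r` (`k = 3r`) is `r · #NCMatching (r − 1)`.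
[cite: KhristoforovSmirnov2021, §2 Lemma 4, proof and Fig. 3 (arXiv v1 p. 4); §1.2 (p. 2)] -/
theorem card_invariantTriangles [DecidableEq (Pic nm)] (hr : 3 * r = nm) (hpos : 0 < r) :
    (Finset.univ.filter fun P : Pic nm => Pic.shift (isCyc_rot_pow r) P = P).card = r * Fintype.card (NCMatching (r - 1)) := by
  rw [← card_isInvTri hr hpos]
  exact (Fintype.card_of_subtype _ fun P => by
    rw [Finset.mem_filter]
    exact ⟨fun h => (shift_eq_self_iff_of_three_mul hr hpos P).1 h.2,
      fun h => ⟨Finset.mem_univ _, (shift_eq_self_iff_of_three_mul hr hpos P).2 h⟩⟩).symm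

/-- ★★★ **… AND FOR ODD `k = 3(2s+1)` IT IS THE CATALAN NUMBER `(2s+1) · C_s = (k/3) · C_{(k−3)/6}`** (`1, 3, 10, 35, …` for `k = 3, 9, 15, 21, …`
— REP's «lane exact tables», now a theorem). [cite: KhristoforovSmirnov2021, §2 Lemma 4, proof and Fig. 3 (arXiv v1 p. 4); §1.2 (p. 2)] -/
theorem card_invariantTriangles_eq_mul_catalan [DecidableEq (Pic nm)] {s : ℕ} (hr : 3 * (2 * s + 1) = nm) :
    (Finset.univ.filter fun P : Pic nm => Pic.shift (isCyc_rot_pow (2 * s + 1)) P = P).card = (2 * s + 1) * catalan s := by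
  rw [card_invariantTriangles hr (by omega), show 2 * s + 1 - 1 = 2 * s by omega, card_ncMatching_two_mul]

/-- ★★★ **THE CHARACTER OF KHRISTOFOROV–SMIRNOV'S ROTATION AT ITS ORDER-THREE ELEMENT, EXPLICITLY**: for `k = 3(2s+1)`,
`tr (rot^{2s+1} | solW k) = −τ² · (2s+1) · C_s` (k = 3: `−τ²`; k = 9: `−3τ²`; k = 15: `−10τ²`; REP's `trace_solWRot_third_eq` with its count
evaluated). [cite: KhristoforovSmirnov2021, §2 Lemma 4, proof and Fig. 3 (arXiv v1 p. 4: «each triple contributes zero»); §1.2 (p. 2)] -/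
theorem trace_solWRot_third_eq_catalan [DecidableEq (Pic nm)] {s : ℕ} (hr : 3 * (2 * s + 1) = nm) :
    LinearMap.trace ℂ (solW nm) (solWRot nm (rot nm ^ (2 * s + 1)) (isCyc_rot_pow (2 * s + 1))).toLinearMap =
      -(tau ^ 2 * ((2 * s + 1) * catalan s : ℕ)) := by
  rw [trace_solWRot_third_eq hr (by omega), card_invariantTriangles_eq_mul_catalan hr]

/-- sanity instances: `k = 9` has `3` invariant triangles and `k = 15` has `10` (REP's table), `k = 21` has `35`.
[cite: KhristoforovSmirnov2021, §2 Lemma 4, proof and Fig. 3 (arXiv v1 p. 4)] -/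
theorem card_invariantTriangles_nine_fifteen [DecidableEq (Pic 9)] [DecidableEq (Pic 15)] [DecidableEq (Pic 21)] :
    (Finset.univ.filter fun P : Pic 9 => Pic.shift (isCyc_rot_pow 3) P = P).card = 3 ∧
    (Finset.univ.filter fun P : Pic 15 => Pic.shift (isCyc_rot_pow 5) P = P).card = 10 ∧
    (Finset.univ.filter fun P : Pic 21 => Pic.shift (isCyc_rot_pow 7) P = P).card = 35 := by
  refine ⟨?_, ?_, ?_⟩
  · rw [card_invariantTriangles_eq_mul_catalan (s := 1) (by norm_num), catalan_one]
  · rw [card_invariantTriangles_eq_mul_catalan (s := 2) (by norm_num), catalan_two]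
  · rw [card_invariantTriangles_eq_mul_catalan (s := 3) (by norm_num), catalan_three]

end Triangles

end Literature.Probability.Percolation.MarkedLoops
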